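import Summits.QuantumAdvantage.QuantumAdvantage.Theses.HankelLift
import Summits.QuantumAdvantage.QuantumAdvantage.Theorems.HankelLiftHankelDiscrepancyRectangle
import Summits.QuantumAdvantage.QuantumAdvantage.Theorems.HankelLiftHankelDiscrepancyMajorArc
import Literature.NumberTheory.LFunctions.MoebiusExpSumMinorArc

/-!
# `HankelLift.HankelDiscrepancy` (stmt-QuantumAdvantage-18439): rectangle discrepancy of the
# Liouville Hankel pattern

Crux (route `route-QuantumAdvantage-HankelLift`, rank 2):
`∀ C, ∀ᶠ n, ∀ S T ⊆ [0,2^n), |∑_{x∈S} ∑_{y∈T} λ(x+y+2)| ≤ 4^n / n^C`.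

Proof = the registered birth line `Cruxes/HankelDiscrepancy/Lines/birth.lean` (Davenport ∘ Parseval)
with both stubs proved:
* minor arcs: the tree's `MoebiusExpSum.liouville_minorArc` (Green 2012 Prop. 4 for `λ`, PROVED);
* major arcs: `HankelLift.liouville_majorArc` (`Theorems/HankelLiftHankelDiscrepancyMajorArc.lean`:
  residues mod `q` + Siegel–Walfisz for `λ` in progressions + summation by parts);
  together they give Davenport's uniform bound `sup_θ ‖∑_{n ≤ N} λ(n)e(nθ)‖ ≤ N/(log N)^A`
  (`HankelLift.davenport_liouville`), put in dyadic form at length `2·2^n + 2`;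
* rectangle ⟸ symbol: `HankelLift.rectangle_sum_le_of_symbol_bound`
  (`Theorems/HankelLiftHankelDiscrepancyRectangle.lean`: discrete Parseval + Cauchy–Schwarz), and
  `√(|S||T|) ≤ 2^n`.
[cite: MontgomeryVaughan2007, §11.3 Exercise 13(f) p. 384] [cite: Green2012, Proposition 4]
-/

set_option linter.dupNamespace false -- D-0017: single-problem summit ⇒ `QuantumAdvantage.QuantumAdvantage` by design

noncomputable section

namespace Summit.QuantumAdvantage.QuantumAdvantage.Theorems

open Finset Real ArithmeticFunction Filter
open scoped FourierTransform
open Literature.NumberTheory.Sieve.Vinogradov (afExpSum)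
open Literature.NumberTheory.LFunctions
open Summit.QuantumAdvantage.QuantumAdvantage.Theses.HankelLift (HankelDiscrepancy)

namespace HankelLift

/-- **Davenport's theorem for the Liouville function** (uniform bound for `∑ λ(n) e(nθ)`): for
every `A`, for all large `N`, `sup_θ ‖∑_{n ≤ N} λ(n) e(nθ)‖ ≤ N/(log N)^A`.  Minor arcs from the
tree's `MoebiusExpSum.liouville_minorArc` (Green 2012, Prop. 4 for `λ`): if the sum exceeded
`N/(log N)^A`, Proposition 4 with `δ = (log N)^{-A}` would place `θ` within `(log N)^{50(A+5)}/N` of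
a reduced `a/q` with `q ≤ (log N)^{50(A+5)}` (once `log N ≥ C₀`), where the major-arc bound
`liouville_majorArc` applies.  (Composition `davenport_of_majorArc` of the birth skeleton.)
[cite: MontgomeryVaughan2007, §11.3 Exercise 13(f) p. 384] [cite: Green2012, Proposition 4] -/
theorem davenport_liouville (A : ℕ) :
    ∀ᶠ N : ℕ in atTop, ∀ θ : ℝ,
      ‖afExpSum (⇑(liouville : ArithmeticFunction ℝ)) N θ‖ ≤ N / Real.log N ^ A := by
  obtain ⟨C₀, hC₀, hmin⟩ := MoebiusExpSum.liouville_minorArc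
  have hlog : ∀ᶠ N : ℕ in atTop, C₀ ≤ Real.log N :=
    (Real.tendsto_log_atTop.comp tendsto_natCast_atTop_atTop).eventually_ge_atTop C₀
  filter_upwards [liouville_majorArc A (50 * (A + 5)), hlog, eventually_ge_atTop 3] with
    N hN hlogN h3 θ
  by_contra hlt
  rw [not_le] at hlt
  have hL1 : 1 ≤ Real.log N := hC₀.trans hlogN
  have hL0 : 0 < Real.log N := one_pos.trans_le hL1
  have hN0 : (0 : ℝ) < N := by exact_mod_cast (by omega : 0 < N)
  have hδ0 : 0 < (Real.log N ^ A)⁻¹ := inv_pos.mpr (pow_pos hL0 A)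
  have hδ1 : (Real.log N ^ A)⁻¹ ≤ 1 := inv_le_one_of_one_le₀ (one_le_pow₀ hL1)
  have hbig : (Real.log N ^ A)⁻¹ * N ≤ ‖afExpSum (⇑(liouville : ArithmeticFunction ℝ)) N θ‖ := by
    rw [inv_mul_eq_div]; exact hlt.le
  obtain ⟨q, hq1, hqle, a, hcop, hθ⟩ := hmin N h3 θ _ hδ0 hδ1 hbig
  have hP : (C₀ * Real.log N ^ 4 / (Real.log N ^ A)⁻¹) ^ 50 ≤ Real.log N ^ (50 * (A + 5)) := by
    rw [pow_mul', div_inv_eq_mul]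
    refine pow_le_pow_left₀ (by positivity) ?_ 50
    have h4 : 0 ≤ Real.log N ^ 4 * Real.log N ^ A :=
      mul_nonneg (pow_nonneg hL0.le _) (pow_nonneg hL0.le _)
    calc C₀ * Real.log N ^ 4 * Real.log N ^ A = C₀ * (Real.log N ^ 4 * Real.log N ^ A) := by ring
      _ ≤ Real.log N * (Real.log N ^ 4 * Real.log N ^ A) := mul_le_mul_of_nonneg_right hlogN h4
      _ = Real.log N ^ (A + 5) := by ring
  have h := hN θ q hq1 (hqle.trans hP) a hcop (hθ.trans (div_le_div_of_nonneg_right hP hN0.le))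
  exact absurd h (not_le.mpr hlt)

/-- Dyadic form of Davenport's bound, in the normalisation the rectangle lemma consumes: for every
`C`, for all large `n`, `sup_θ ‖∑_{m ≤ 2·2^n+2} λ(m) e(mθ)‖ ≤ 2^n / n^C` (from `davenport_liouville`
at `A = C + 1`, since `log(2·2^n+2) ≥ n/2` and `n ≥ 2^{C+3}`). [folklore] -/
theorem davenport_liouville_dyadic (C : ℕ) :
    ∀ᶠ n : ℕ in atTop, ∀ θ : ℝ,
      ‖afExpSum (⇑(liouville : ArithmeticFunction ℝ)) (2 * 2 ^ n + 2) θ‖ ≤ 2 ^ n / (n : ℝ) ^ C := by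
  -- `n/2 ≤ log (2·2^n + 2)`
  have hhalf : ∀ n : ℕ, (n : ℝ) / 2 ≤ Real.log ((2 * 2 ^ n + 2 : ℕ) : ℝ) := by
    intro n
    have h2 : (n : ℝ) * Real.log 2 ≤ Real.log ((2 * 2 ^ n + 2 : ℕ) : ℝ) := by
      rw [← Real.log_pow]
      refine Real.log_le_log (by positivity) ?_
      push_cast
      nlinarith [show (0 : ℝ) ≤ 2 ^ n by positivity]
    have hn : (0 : ℝ) ≤ n := Nat.cast_nonneg n
    nlinarith [Real.log_two_gt_d9, h2, hn]
  -- the real-number inequality: `n ≥ 2^(C+3)`, `L ≥ n/2` ⇒ `(2·2^n + 2)/L^(C+1) ≤ 2^n/n^C`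
  have hineq : ∀ n : ℕ, 2 ^ (C + 3) ≤ n → ∀ L : ℝ, (n : ℝ) / 2 ≤ L →
      ((2 * 2 ^ n + 2 : ℕ) : ℝ) / L ^ (C + 1) ≤ 2 ^ n / (n : ℝ) ^ C := by
    intro n hn L hL
    have hn8 : (2 : ℝ) ^ (C + 3) ≤ n := by exact_mod_cast hn
    have hn0 : (0 : ℝ) < n := lt_of_lt_of_le (by positivity) hn8
    have hL0 : 0 < L := by linarith
    have hpow : ((n : ℝ) / 2) ^ (C + 1) ≤ L ^ (C + 1) := pow_le_pow_left₀ (by positivity) hL _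
    rw [div_le_div_iff₀ (by positivity) (by positivity)]
    push_cast
    calc (2 * 2 ^ n + 2 : ℝ) * (n : ℝ) ^ C ≤ (4 * 2 ^ n) * (n : ℝ) ^ C := by
          gcongr
          linarith [one_le_pow₀ (show (1 : ℝ) ≤ 2 by norm_num) (n := n)]
      _ = 2 ^ n * (2 ^ (C + 3) * (n : ℝ) ^ C / 2 ^ (C + 1)) := by
          field_simp
          ring
      _ ≤ 2 ^ n * ((n : ℝ) * (n : ℝ) ^ C / 2 ^ (C + 1)) := by gcongr
      _ = 2 ^ n * ((n : ℝ) / 2) ^ (C + 1) := by rw [div_pow]; ring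
      _ ≤ 2 ^ n * L ^ (C + 1) := by gcongr
  have hT : Tendsto (fun n : ℕ => 2 * 2 ^ n + 2) atTop atTop :=
    tendsto_atTop_atTop.2 fun b => ⟨b, fun n hn => by have := @Nat.lt_two_pow_self n; omega⟩
  filter_upwards [hT.eventually (davenport_liouville (C + 1)), eventually_ge_atTop (2 ^ (C + 3))]
    with n hDn hn θ
  exact (hDn θ).trans (hineq n hn _ (hhalf n))

end HankelLift

open HankelLift in
/-- **`HankelDiscrepancy`** (stmt-QuantumAdvantage-18439, crux of route `HankelLift`): for every `C`,
for all large `n`, every pair of sets `S, T ⊆ [0, 2^n)` has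
`|∑_{x∈S} ∑_{y∈T} λ(x+y+2)| ≤ 4^n / n^C` — the rectangle discrepancy of the Liouville Hankel pattern.
Davenport's uniform bound (minor arcs `MoebiusExpSum.liouville_minorArc` + major arcs
`liouville_majorArc`) at length `2·2^n + 2`, the rectangle-from-symbol lemma
`rectangle_sum_le_of_symbol_bound` (discrete Parseval, shift `s = 2`), and `√(|S||T|) ≤ 2^n`.
[cite: MontgomeryVaughan2007, §11.3 Exercise 13(f) p. 384] [cite: Green2012, Proposition 4] -/
theorem hankelDiscrepancy_proof : HankelDiscrepancy := by
  intro C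
  filter_upwards [davenport_liouville_dyadic C] with n hDn S T
  have hrect := rectangle_sum_le_of_symbol_bound (2 ^ n) 2 (by norm_num)
    (⇑(liouville : ArithmeticFunction ℝ)) _
    (fun θ => by simpa [two_mul, pow_succ, mul_comm] using hDn θ) S T
  have hB0 : (0 : ℝ) ≤ 2 ^ n / (n : ℝ) ^ C := by positivity
  have hS : (S.card : ℝ) ≤ 2 ^ n := by exact_mod_cast card_finset_fin_le S
  have hT : (T.card : ℝ) ≤ 2 ^ n := by exact_mod_cast card_finset_fin_le T
  have hsqrt : Real.sqrt ((S.card : ℝ) * (T.card : ℝ)) ≤ 2 ^ n :=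
    calc Real.sqrt ((S.card : ℝ) * (T.card : ℝ)) ≤ Real.sqrt (2 ^ n * 2 ^ n) :=
          Real.sqrt_le_sqrt (mul_le_mul hS hT (Nat.cast_nonneg _) (by positivity))
      _ = 2 ^ n := Real.sqrt_mul_self (by positivity)
  simp only [intCoe_apply] at hrect
  refine hrect.trans ?_
  calc 2 ^ n / (n : ℝ) ^ C * Real.sqrt ((S.card : ℝ) * (T.card : ℝ))
      ≤ 2 ^ n / (n : ℝ) ^ C * 2 ^ n := mul_le_mul_of_nonneg_left hsqrt hB0
    _ = (4 : ℝ) ^ n / (n : ℝ) ^ C := by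
        rw [show (4 : ℝ) = 2 * 2 by norm_num, mul_pow]; ring

end Summit.QuantumAdvantage.QuantumAdvantage.Theorems
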